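import Literature.NumberTheory.Rogawski1990.ArchCentralJetBoundsAllFrames            -- ★ p851226 (this seat): `rootProduct_comp_perm`; brings ★ `rootProduct`, `circleDiagonal`, `archLocal`
import Literature.NumberTheory.Rogawski1990.ArchCentralLimitJetBoundsOfBootstrap     -- ★ p846633 (F0P3a-p02 (g15)): `one_sub_cexp_mul_I_eq`, `contDiff_dslope_cexp_zero`, `dslope_cexp_zero_zero`
import Literature.NumberTheory.Automorphic.ArchInnerFormChartLocal                  -- ★ `gprimeBlockAt`, `gprimeBlock_eq_gprimeBlockAt`; brings ★ `coe_gprimeBlock_of_not_mem`, `gprimeCptGL`, `lineOf`, `formSign`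
import HarnessLib

/-!
# Scalar-corner bookkeeping for the `G′`-atlas at a compact place: the compact normaliser factor is «entire × `rootProduct`», and the chart's torus point is `diag(ζ · e^{iθ})`
# (Rogawski 1990 §3.6, §8.2; Shelstad 1979 §4; Warner II §8.4.1)

Topic `NumberTheory/Rogawski1990`; namespace `Literature.NumberTheory.Rogawski1990`.  THEOREMS ONLY (no `def`, no instance, no notation, no axiom, no named fact, no `sorry`).
Cell `pub/hodgecm-mathlib`, crux H413 (`stmt-HodgeConjecture-24833`), F0∕P3c line LH3 (closer stub `stub_N9`, letter L1 clause (I₁)), organ O-L1d «HC-CENTRAL» (B3): the two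
BOOKKEEPING SLIVERS (s1)∕(s2) of the (B3-JUNCTION) J2 `hfac` (holder A-p12 (g28); J1 ★-filed p851263), typed by F0P3a-p09 (g7) (author of the (B3-ENGINE) ★ p851226) so that J2 imports
them by name.  Count-neutral.

* §1 (s1) **`exists_contDiff_cptFactor_eq_mul_rootProduct_sub`** — at a compact place `w` and a SCALAR base point `x` (`x w l` all equal), for ANY relabelling `τ ∈ S₃`:
  the compact factor of Shelstad's normaliser ★ `archRG_eq_prod_cpt_mul_prod_split`, `(1 − e^{i(c_w1−c_w0)})(1 − e^{i(c_w2−c_w0)})(1 − e^{i(c_w2−c_w1)})`, equals `v(c) · rootProduct(θ(c))` with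
  `θ(c)_k = c w (τ⁻¹ k) − x w (τ⁻¹ k)` (the (B3-ENGINE)'s angles at the centre `ζ = e^{i x_w}`) and `v` real-smooth on ALL of the coordinate space (`1 − e^{it} = −it·E(it)`, `E = dslope exp 0`
  entire; `rootProduct` is translation-invariant along `(1,1,1)` and alternating under `τ`).
* §2 (s2) **`gprimeBlockAt_eq_circleDiagonal_centre_of_scalar`** — at `w ∉ S′` and `x` scalar at `w`: the chart's torus point IS the engine's torus point,
  `gprimeBlockAt L α w S′ (c w) = ⟨circleDiagonal 3 (fun k => Circle.exp (x w 0) * Circle.exp (θ(c)_k)), _⟩` with `τ = lineOf (formSign L α w)`.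
HONEST LABEL: HC_CM is proved only modulo the 7 printed citations (2 remaining: hLiu418 = `stmt-HodgeConjecture-24832`, h413 = `stmt-HodgeConjecture-24833`) until rung 0 closes.

## References
* [Rogawski1990] J. D. Rogawski, *Automorphic Representations of Unitary Groups in Three Variables*, Ann. of Math. Stud. 123 (1990), §3.6 p. 31, §8.2 p. 122.
* [Shelstad1979] D. Shelstad, *Characters and inner forms of a quasi-split group over ℝ*, Compositio Math. 39 (1979), §4 p. 22 (`R_T`).
* [WarnerHASSLG2] G. Warner, *Harmonic Analysis on Semi-Simple Lie Groups II*, Grundlehren 189 (1972), §8.4.1 (`π = ∏ α`).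
-/

set_option autoImplicit false

noncomputable section

open Complex NumberField NumberField.InfinitePlace Matrix Equiv
open Literature.NumberTheory.Automorphic Literature.NumberTheory.Automorphic.UnitaryGroup Literature.NumberTheory.Automorphic.ArchCartan
open Literature.Geometry.ComplexHyperbolic.BallModel
open scoped MatrixGroups ContDiff

namespace Literature.NumberTheory.Rogawski1990

/-! ## §1 (s1) The compact normaliser factor at a scalar place is «entire × `rootProduct` of the shifted relabelled angles» -/

section CptFactor

variable {W : Type*} [Fintype W] (w : W)

/-- `rootProduct` is invariant under subtracting a CONSTANT angle vector (central translation). [cite: WarnerHASSLG2, §8.4.1] -/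
theorem rootProduct_sub_const (θ : Fin 3 → ℝ) (a : ℝ) : rootProduct (fun k => θ k - a) = rootProduct θ := by
  simp only [rootProduct]
  ring

/-- **(s1) THE COMPACT FACTOR OF `archRG` AT A SCALAR PLACE = ENTIRE × `rootProduct` OF THE SHIFTED RELABELLED ANGLES.**  For ANY `τ ∈ S₃` and any base point `x` scalar at `w`
(`x w l` all equal) there is a real-smooth `v` on the whole coordinate space with
`(1 − e^{i(c_w1 − c_w0)})(1 − e^{i(c_w2 − c_w0)})(1 − e^{i(c_w2 − c_w1)}) = v(c) · rootProduct (k ↦ c w (τ⁻¹ k) − x w (τ⁻¹ k))` for EVERY `c` (`1 − e^{it} = −it·E(it)` with `E = dslope exp 0`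
entire, ★ `one_sub_cexp_mul_I_eq`; `rootProduct ∘ (· ∘ τ⁻¹) = sign(τ⁻¹) · rootProduct`, ★ `rootProduct_comp_perm`; translation invariance).  The `u`-half of J1's `hfac` against
★ `archRG_eq_prod_cpt_mul_prod_split`. [cite: Shelstad1979, §4 p. 22] [cite: Rogawski1990, §8.2 p. 122] [cite: WarnerHASSLG2, §8.4.1] -/
theorem exists_contDiff_cptFactor_eq_mul_rootProduct_sub (τ : Equiv.Perm (Fin 3)) (x : W → Fin 3 → ℝ) (hxw : ∀ l l' : Fin 3, x w l = x w l') :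
    ∃ v : (W → Fin 3 → ℝ) → ℂ, ContDiff ℝ ∞ v ∧ ∀ c : W → Fin 3 → ℝ,
      (1 - (Circle.exp (c w 1 - c w 0) : ℂ)) * (1 - (Circle.exp (c w 2 - c w 0) : ℂ)) * (1 - (Circle.exp (c w 2 - c w 1) : ℂ)) =
        v c * ((rootProduct (fun k => c w (τ.symm k) - x w (τ.symm k)) : ℝ) : ℂ) := by
  refine ⟨fun c => ((Equiv.Perm.sign τ.symm : ℤ) : ℂ) * (-I) * dslope Complex.exp 0 (((c w 1 - c w 0 : ℝ) : ℂ) * I) *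
      dslope Complex.exp 0 (((c w 2 - c w 0 : ℝ) : ℂ) * I) * dslope Complex.exp 0 (((c w 2 - c w 1 : ℝ) : ℂ) * I), ?_, fun c => ?_⟩
  · have hlin : ∀ i j : Fin 3, ContDiff ℝ ∞ (fun c : W → Fin 3 → ℝ => ((c w i - c w j : ℝ) : ℂ) * I) := fun i j =>
      (Complex.ofRealCLM.contDiff.comp (((contDiff_apply_apply ℝ ℝ w i)).sub (contDiff_apply_apply ℝ ℝ w j))).mul contDiff_const
    have hE := contDiff_dslope_cexp_zero
    exact (((contDiff_const.mul (hE.comp (hlin 1 0))).mul (hE.comp (hlin 2 0))).mul (hE.comp (hlin 2 1)))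
  · -- the shifted relabelled `rootProduct` is `sign(τ⁻¹) · rootProduct (c w)`
    have hroot : rootProduct (fun k => c w (τ.symm k) - x w (τ.symm k)) = ((Equiv.Perm.sign τ.symm : ℤ) : ℝ) * rootProduct (c w) := by
      have h1 : (fun k => c w (τ.symm k) - x w (τ.symm k)) = fun k => ((c w) ∘ ⇑τ.symm) k - x w 0 := by
        funext k; rw [Function.comp_apply, hxw (τ.symm k) 0]
      rw [h1, rootProduct_sub_const, rootProduct_comp_perm]
    rw [hroot, Circle.coe_exp, Circle.coe_exp, Circle.coe_exp, one_sub_cexp_mul_I_eq, one_sub_cexp_mul_I_eq, one_sub_cexp_mul_I_eq]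
    simp only [rootProduct]
    have hs : ((Equiv.Perm.sign τ.symm : ℤ) : ℂ) ^ 2 = 1 := by
      rw [← Int.cast_pow, ← Units.val_pow_eq_pow_val, Int.units_sq, Units.val_one, Int.cast_one]
    push_cast
    linear_combination ((↑(c w 0) - ↑(c w 1)) * (↑(c w 0) - ↑(c w 2)) * (↑(c w 1) - ↑(c w 2)) *
      dslope Complex.exp 0 ((↑(c w 1) - ↑(c w 0)) * I) * dslope Complex.exp 0 ((↑(c w 2) - ↑(c w 0)) * I) * dslope Complex.exp 0 ((↑(c w 2) - ↑(c w 1)) * I) * I) *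
        (Complex.I_sq + hs)

end CptFactor

/-! ## §2 (s2) At a scalar base point the chart's torus point at `w ∉ S′` is the engine's `diag(ζ · e^{iθ(c)})` -/

section TorusPoint

variable (L : Type) [Field L] (α : Fin 3 → L) (w : {w : InfinitePlace L // IsComplex w}) (S' : Finset {w : InfinitePlace L // IsComplex w})

/-- **(s2) THE CHART'S TORUS POINT AT A SCALAR CORNER**: for `w ∉ S′` and `x` scalar at `w` (`x w l` all equal), with `τ = lineOf (formSign L α w)`, `ζ = e^{i x_{w0}}` and the
shifted relabelled angles `θ(c)_k = c w (τ⁻¹ k) − x w (τ⁻¹ k)`:  `gprimeBlockAt L α w S′ (c w) = diag(ζ · e^{iθ(c)_k})` — EXACTLY the torus point of the (B3-ENGINE) ★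
`exists_forall_norm_iteratedFDeriv_rootProduct_smul_orbital_le` and of ★ (J-iso) §2's `g * gprimeBlockAt L α w₀ S′ (c w₀) * g⁻¹` (★ `coe_gprimeBlock_of_not_mem`, ★ `gprimeCptGL`,
`e^{i(a+t)} = e^{ia}e^{it}`). [cite: Rogawski1990, §3.6 p. 31; §8.2 p. 122] -/
theorem gprimeBlockAt_eq_circleDiagonal_centre_of_scalar (hw : w ∉ S') {x : {w : InfinitePlace L // IsComplex w} → Fin 3 → ℝ}
    (hxw : ∀ l l' : Fin 3, x w l = x w l') (c : {w : InfinitePlace L // IsComplex w} → Fin 3 → ℝ) :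
    gprimeBlockAt L α w S' (c w) =
      ⟨circleDiagonal 3 (fun k => Circle.exp (x w 0) * Circle.exp (c w ((lineOf (formSign L α w)).symm k) - x w ((lineOf (formSign L α w)).symm k))),
        circleDiagonal_mem_archLocal_diagonal L 3 α w _⟩ := by
  apply Subtype.ext
  show ((gprimeBlock L α w S' (fun _ => c w) : ↥(archLocal L 3 (Matrix.diagonal α) w)) : GL (Fin 3) ℂ) = _
  rw [coe_gprimeBlock_of_not_mem L α (fun _ => c w) hw, gprimeCptGL]
  congr 1
  funext k
  rw [← Circle.exp_add, hxw 0 ((lineOf (formSign L α w)).symm k), add_sub_cancel]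

/-- The same torus point read INSIDE a conjugation `g · γ · g⁻¹` (the literal token of ★ (J-iso) §2 `chartOrbG_eq_prod_mul_integral_group_isolate_of_not_mem`).
[cite: Rogawski1990, §8.2 p. 122] -/
theorem conj_gprimeBlockAt_eq_conj_circleDiagonal_centre_of_scalar (hw : w ∉ S') {x : {w : InfinitePlace L // IsComplex w} → Fin 3 → ℝ}
    (hxw : ∀ l l' : Fin 3, x w l = x w l') (c : {w : InfinitePlace L // IsComplex w} → Fin 3 → ℝ) (g : ↥(archLocal L 3 (Matrix.diagonal α) w)) :
    g * gprimeBlockAt L α w S' (c w) * g⁻¹ =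
      g * ⟨circleDiagonal 3 (fun k => Circle.exp (x w 0) * Circle.exp (c w ((lineOf (formSign L α w)).symm k) - x w ((lineOf (formSign L α w)).symm k))),
        circleDiagonal_mem_archLocal_diagonal L 3 α w _⟩ * g⁻¹ := by
  rw [gprimeBlockAt_eq_circleDiagonal_centre_of_scalar L α w S' hw hxw c]

end TorusPoint

end Literature.NumberTheory.Rogawski1990

end
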